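import Summits.CriticalPhenomena.PercolationContinuityZ3.Theorems.PercNearOneGluingNoHeavyLowerTailSunflowerWSplit
import HarnessLib

/-!
# `NoHeavyLowerTail` (crux stmt-CriticalPhenomena-4575), abstract sunflower cubic: the `{w=1}`-face budget does NOT
# replace the `H`-face budget — (RES0′) is FALSE from the six budgets `y, k, g, h, Ȳ, W`

Support file (seat `prim-ineq-prove-1` gen 60; `--supports stmt-CriticalPhenomena-4575`).  No `sorry`, no named facts.
Memo: run/shared/lean/prim/prim-ineq-prove-1/FINDING-HFACE-prove1-g60.md.

Gen 59 (`…SunflowerWSplit`, memo FINDING-KAPPAONE-prove1-g59 §5(c)) conjectured **(W5)**: in the two-linked-systems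
model of (RES0′) (coins `τ, σ, s`, floors `α₀₀ ≤ α₀₁ ≤ α₁₁`, petals `(y,k,g,h)` with the links `y ≤ k`, `g ≤ k`, `g ≤ h`
and caps `≤ 1`, leaf-leaf constant `c₀ = τσ + (1−τ)(1−s)α₀₀`), the conclusion `∏ G_j ≤ (g*)^(n−1)·a` follows for every
`n` from the cell budgets `(By) (Bk) (Bh)`, the `Ȳ`-face budget and the `{w=1}`-face budget `(BW)` alone, i.e. WITHOUT
the `H`-face budget `(BH) ∏ H_j ≤ b_H^(n−1)`.  This file records the statement (`ResZeroSixBudgets`, with `(Bg)` thrown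
in as well) and REFUTES it (`not_resZeroSixBudgets`) by an explicit rational five-petal family at the resonance
`α₁₁² ≈ α₀₁` (`N* = 2`): two leverage dwarfs (`k = g = α₁₁`, resp. `k = g` just below `α₁₁`, `h` at its floor), one
full `h`-petal (`h = 1`), and two cheap-`y` petals (`y = α₀₁`, resp. `y` tuned to exhaust the `Ȳ`-face), at
`(τ,σ,s) = (73/1000, 31/500000, 67/100)`, `(α₀₀,α₀₁,α₁₁) = (7·10⁻⁷, 11/6250, 419/10⁴)`.  All six budgets, all links
and all caps hold (the `W`- and `Ȳ`-face budgets with slack `< 10⁻¹⁹`), while `∏ G_j` exceeds `(g*)⁴·a` by the factor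
`1.00043995`.  The family violates `(BH)` (by the factor `(1/b_H)^0.00074`): the dwarf pair uses LESS of the `{w=1}` face
than of the `H` face (the face `{w=1}` carries the extra constant atom `τσ`), and that slack is exactly what admits the
full `h`-petal next to it.  Consequence for the programme: every all-`n` statement of (RES0′) must keep the `H`-face
budget; the `w`-coin split handles the `y`-floor / W-dominant classes (`res0_Wdominant`, true) but is not a substitute.
-/

noncomputable section

namespace Summit.CriticalPhenomena.PercolationContinuityZ3.Theorems.SunflowerPartition

namespace SafeCalc

namespace LinkedCurrency

open Finset

/-- **(W5) / "six budgets suffice"** — the statement refuted below.  For all coins `0 < τ, σ, s < 1`, floors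
`0 < α₀₀ ≤ α₀₁ ≤ α₁₁ ≤ 1`, every constant `c₀ ≥ τσ + (1−τ)(1−s)α₀₀`, and every finite petal family `(y_j,k_j,g_j,h_j)`
with `α₀₀ ≤ y_j ≤ k_j ≤ 1`, `α₀₁ ≤ g_j ≤ k_j`, `g_j ≤ h_j`, `α₁₁ ≤ h_j ≤ 1`, the six Lemma-A budgets
`∏ y_j ≤ α₀₀^(n−1)`, `∏ k_j ≤ α₀₁^(n−1)`, `∏ g_j ≤ α₀₁^(n−1)`, `∏ h_j ≤ α₁₁^(n−1)`,
`∏ ((1−s)y_j + s k_j) ≤ ((1−s)α₀₀ + sα₀₁)^(n−1)` (`Ȳ`-face) and `∏ W_j ≤ w_f^(n−1)` (`{w=1}`-face,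
`W = τσ + τ(1−σ)k + (1−τ)((1−σ)g + σh)`) imply
`∏ (c₀ + τ(1−σ)((1−s)y_j + s k_j) + s(1−τ)((1−σ)g_j + σh_j)) ≤ (g*)^(n−1)·(c₀ + τ(1−σ) + s(1−τ))`.
FALSE: `not_resZeroSixBudgets`. [gen 59 conjecture (W5); refuted in this work] -/
def ResZeroSixBudgets : Prop :=
  ∀ (ι : Type) (S : Finset ι) (τ σ s α00 α01 α11 c0 : ℝ) (y k gc h : ι → ℝ),
    0 < τ → τ < 1 → 0 < σ → σ < 1 → 0 < s → s < 1 → 0 < α00 → α00 ≤ α01 → α01 ≤ α11 → α11 ≤ 1 →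
    τ * σ + (1 - τ) * (1 - s) * α00 ≤ c0 →
    (∀ j ∈ S, α00 ≤ y j ∧ y j ≤ k j ∧ k j ≤ 1) →
    (∀ j ∈ S, α01 ≤ gc j ∧ gc j ≤ k j ∧ gc j ≤ h j) →
    (∀ j ∈ S, α11 ≤ h j ∧ h j ≤ 1) →
    ∏ j ∈ S, y j ≤ α00 ^ (S.card - 1) →
    ∏ j ∈ S, k j ≤ α01 ^ (S.card - 1) →
    ∏ j ∈ S, gc j ≤ α01 ^ (S.card - 1) →
    ∏ j ∈ S, h j ≤ α11 ^ (S.card - 1) →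
    ∏ j ∈ S, ((1 - s) * y j + s * k j) ≤ ((1 - s) * α00 + s * α01) ^ (S.card - 1) →
    ∏ j ∈ S, (τ * σ + τ * (1 - σ) * k j + (1 - τ) * ((1 - σ) * gc j + σ * h j)) ≤
      (τ * σ + τ * (1 - σ) * α01 + (1 - τ) * ((1 - σ) * α01 + σ * α11)) ^ (S.card - 1) →
    ∏ j ∈ S, (c0 + τ * (1 - σ) * ((1 - s) * y j + s * k j) + s * (1 - τ) * ((1 - σ) * gc j + σ * h j)) ≤
      (c0 + τ * (1 - σ) * ((1 - s) * α00 + s * α01) + s * (1 - τ) * ((1 - σ) * α01 + σ * α11)) ^ (S.card - 1) *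
        (c0 + τ * (1 - σ) + s * (1 - τ))

/-- **Refutation of (W5): the six budgets `y, k, g, h, Ȳ, W` do not imply (RES0′).**  Five petals `(y,k,g,h)`:
`(α₀₀, α₁₁, α₁₁, α₁₁)`, `(α₀₀, t, t, α₁₁)` with `t = 10221133/250000000`, `(α₀₀, α₀₁, α₀₁, 1)`,
`(α₀₁, α₀₁, α₀₁, α₁₁)`, `(y₂, α₀₁, α₀₁, α₁₁)` with `y₂ = 10000653/10¹¹`, at `τ = 73/1000`, `σ = 31/500000`,
`s = 67/100`, `α₀₀ = 7/10⁷`, `α₀₁ = 11/6250`, `α₁₁ = 419/10000`, `c₀ = τσ + (1−τ)(1−s)α₀₀`: every hypothesis of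
`ResZeroSixBudgets` holds and the conclusion fails by the factor `1.00043995`.  (The family violates the `H`-face
budget, which is therefore necessary.) [this work] -/
theorem not_resZeroSixBudgets : ¬ ResZeroSixBudgets := by
  intro hW
  have key := hW (Fin 5) Finset.univ (73/1000) (31/500000) (67/100) (7/10000000) (11/6250) (419/10000)
    (73/1000 * (31/500000) + (1 - 73/1000) * (1 - 67/100) * (7/10000000))
    ![7/10000000, 7/10000000, 7/10000000, 11/6250, 10000653/100000000000]
    ![419/10000, 10221133/250000000, 11/6250, 11/6250, 11/6250]
    ![419/10000, 10221133/250000000, 11/6250, 11/6250, 11/6250]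
    ![419/10000, 419/10000, 1, 419/10000, 419/10000]
    (by norm_num) (by norm_num) (by norm_num) (by norm_num) (by norm_num) (by norm_num) (by norm_num)
    (by norm_num) (by norm_num) (by norm_num) (by norm_num)
    (by intro j _; fin_cases j <;> norm_num)
    (by intro j _; fin_cases j <;> norm_num)
    (by intro j _; fin_cases j <;> norm_num)
    (by simp only [Fin.prod_univ_five, Matrix.cons_val_zero, Matrix.cons_val_one, Matrix.cons_val_two,
      Matrix.cons_val_three, Matrix.cons_val_four, Matrix.head_cons, Matrix.tail_cons]; norm_num)
    (by simp only [Fin.prod_univ_five, Matrix.cons_val_zero, Matrix.cons_val_one, Matrix.cons_val_two,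
      Matrix.cons_val_three, Matrix.cons_val_four, Matrix.head_cons, Matrix.tail_cons]; norm_num)
    (by simp only [Fin.prod_univ_five, Matrix.cons_val_zero, Matrix.cons_val_one, Matrix.cons_val_two,
      Matrix.cons_val_three, Matrix.cons_val_four, Matrix.head_cons, Matrix.tail_cons]; norm_num)
    (by simp only [Fin.prod_univ_five, Matrix.cons_val_zero, Matrix.cons_val_one, Matrix.cons_val_two,
      Matrix.cons_val_three, Matrix.cons_val_four, Matrix.head_cons, Matrix.tail_cons]; norm_num)
    (by simp only [Fin.prod_univ_five, Matrix.cons_val_zero, Matrix.cons_val_one, Matrix.cons_val_two,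
      Matrix.cons_val_three, Matrix.cons_val_four, Matrix.head_cons, Matrix.tail_cons]; norm_num)
    (by simp only [Fin.prod_univ_five, Matrix.cons_val_zero, Matrix.cons_val_one, Matrix.cons_val_two,
      Matrix.cons_val_three, Matrix.cons_val_four, Matrix.head_cons, Matrix.tail_cons]; norm_num)
  simp only [Fin.prod_univ_five, Matrix.cons_val_zero, Matrix.cons_val_one, Matrix.cons_val_two,
      Matrix.cons_val_three, Matrix.cons_val_four, Matrix.head_cons, Matrix.tail_cons] at key
  norm_num at key

end LinkedCurrency

end SafeCalc

end Summit.CriticalPhenomena.PercolationContinuityZ3.Theorems.SunflowerPartition
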